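import Summits.Ventures.CertifiedManyBodySolver.Observables.StiffnessThermalOddMomentHook
import Literature.MathematicalPhysics.QuantumLattice.HubbardTTPrimeCanonicalStatesChargedRows
import Literature.MathematicalPhysics.QuantumLattice.HubbardTTPrimeChemicalPotentialBand
import Literature.MathematicalPhysics.QuantumLattice.InfVolFermionStateTorusLimitBogoliubovRow
import Literature.MathematicalPhysics.QuantumLattice.FermionTorusTranslationSums
import HarnessLib

/-!
# Route «hubbard-tc-thermcert-1» (`Theses/TcThermcert1.lean`): the objects its crux lines posit — local trial generator `a`,
# its three local words, the thermal row class, the supporting chemical potentials, and the certificate statements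

HONEST FRAMING: DEFINITIONS and statement `Prop`s only (plus window arithmetic and one `Iff.rfl`); nothing about the Hubbard model is
proved in this file; no certificate and no number lives here; KT ceilings never assert superconductivity; NO lower bound on `T_c` is
claimed; no summit, rung or crux statement is proved. Cell `pub/hubbard-tc` × `speedrun/mbsolver/hubbard-thermal` (D-0154 (1) block (D)),
typed by seat `hubbard-thermal-p4` on the cell lead's RULING R133 (2) and the K1-line author's GO (hub-tc-therm-plan-1, 2026-08-28).

These are, VERBATIM (namespace apart), the §0/§1/§4 objects of the REGISTERED crux-line skeletons of the route
(`Cruxes/ThermalStiffnessCeilingU8b10_le_1o8/Lines/trialgen_b10.lean`, hub-tc-therm-plan-1, v2b sha16 752f7dabfdb82980 — crux K1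
`TcThermcert1.ThermalStiffnessCeilingU8b10_le_1o8`, item stmt-Ventures-26381; byte-identical §0 in the K2 line «vertex» of hub-tc-therm-plan-2,
sha16 135a6fd895490092, crux `TcThermcert1.ThermalStiffnessCeilingBoxb10_le_9o71`, item stmt-Ventures-26382), collected ONCE so that stub and
helper files under `Theorems/` can import them (a Theorems file cannot import a `Cruxes/…/Lines` workfile):

* §0 the local trial generator `a ∈ 𝔄_{[-r,r]²}` and its three local words `d_a = curCommDensity`, `h_a = hamCommLocal`,
  `m_a = doubleCommDensity`, the trial-generator word `W_a = trialWord t′ U r a = ½Γk₀ + i·Γd_a + ½m_a ∈ 𝔄_{[-(3r+2),3r+2]²}`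
  (DLS 1978 (27)–(28) with the translation sum `C_a = Σ_v T_v Γa` as trial operator), admissibility `IsTrialGenerator`
  (Hermitian, even, `[a,N] = [a,S^z] = 0`), the lattice-gas chemical-potential band `InMuBand`, and the THERMAL ROW CLASS
  `IsThermalRowState β t′ U n μ₀ ω` (translation invariance, density, GC stationarity + energy–entropy-balance rows for every local
  generator w.r.t. `gcLocalHamiltonianTT'`, canonical Bogoliubov rows — the feasible set of hubbard-thermal's `T > 0` relaxation);
* §1 the statements: `TrialGeneratorHook` (STUB 1 of both lines — PROVED in the tree: `Observables/StiffnessThermalTrialGeneratorHook.lean`,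
  `ObsThermalStiffnessSeqCeilingAtBeta_of_torusLimit_trialGeneratorWord_le`, p610464 + p611646), the supporting chemical potentials
  `IsSupportingMu` (the contact equation of `exists_chemicalPotential_mem_band`), the K1 certificate statement `TrialGeneratorCertificateB10`
  (STUB 2 of «trialgen_b10»: per banded supporting `μ₀`, a certified trial-generator word `≤ 1/8` at `β·t = 10`, `(8, 7/8, 0)`), and its
  generic `(β, q)` form `TrialGeneratorCertificateAt β q` at the anchor (rung socket of RULINGS R129/R133: `β·t = 6`, `q = 21/100`;
  `β·t = 5`, `q = 14/55`), with `trialGeneratorCertificateB10_iff : … ↔ TrialGeneratorCertificateAt 10 (1/8)` (`Iff.rfl`).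

WHAT THIS IS NOT: no certificate of any word exists today (the certificates are the producers' object, route cruxes K1/K2); the proved
row admissibility (`isThermalRowState_of_supportingMu`, hub-tc-therm-crit-2 ∕ plan-1) and the sockets live in the line files ∕ helper files.

References: DLS1978 §2 eqs. (22′), (27), (28); BratteliRobinsonII1997 Thm. 6.2.4, §5.2.2; FawziFawziScalet2024 Thm. 3.1; ArakiMoriya2003
Thm. 12.11; ScalapinoWhiteZhang1993 §II; HazraVermaRanderia2019 eqs. (2)–(4); Lipparini2008 eq. (8.30).
-/

noncomputable section

namespace Summit.Ventures.CertifiedManyBodySolver.Theorems.TcThermcert1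

open Filter Topology Matrix Finset
open Literature.MathematicalPhysics.QuantumLattice
open Literature.MathematicalPhysics.QuantumLattice.ThermodynamicLimit
open Literature.MathematicalPhysics.QuantumFieldTheory
open Literature.MathematicalPhysics.StatisticalMechanics
open Literature.Probability.LatticeModels
open Summit.Ventures.CertifiedManyBodySolver.Observables
open scoped ComplexConjugate ComplexOrder

/-! ## §0 The objects: local trial generator `a`, its three local words, the thermal row class -/

/-- Window arithmetic (`[-1,1]² ⊆ [-(3r+2),3r+2]²`). [folklore] -/
theorem one_le (r : ℕ) : 1 ≤ 3 * r + 2 := by omega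
/-- Window arithmetic (`[-r,r]² ⊆ [-(r+2),r+2]²`). [folklore] -/
theorem r_le_r2 (r : ℕ) : r ≤ r + 2 := by omega
/-- Window arithmetic (`[-(r+2),r+2]² ⊆ [-(3r+2),3r+2]²`). [folklore] -/
theorem r2_le (r : ℕ) : r + 2 ≤ 3 * r + 2 := by omega
/-- Window arithmetic (`[-r,r]² ⊆ [-(r+1),r+1]²`). [folklore] -/
theorem r_le_r1 (r : ℕ) : r ≤ r + 1 := by omega
/-- Window arithmetic (`[-(r+1),r+1]² ⊆ [-(3r+2),3r+2]²`). [folklore] -/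
theorem r1_le (r : ℕ) : r + 1 ≤ 3 * r + 2 := by omega

/-- `d_a = Σ_{z ∈ [-(r+1), r+1]²} [τ_z j₀, a] ∈ 𝔄_{[-(r+2), r+2]²}` — the local density of `[𝒥, C_a]`, `𝒥 = curOpTT' L t′`,
`C_a = Σ_v T_v Γa`. [cite: BratteliRobinsonII1997, Thm. 6.2.4] -/
def curCommDensity (tp : ℝ) (r : ℕ) (a : FermionOp (box 2 r)) : FermionOp (box 2 (r + 2)) :=
  commDensity (box 2 (r + 2)) (box 2 (r + 1)) (box_subset_box (r_le_r2 r)) (curBondObsTT tp) a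

/-- `h_a = H_{[-(r+1), r+1]²} Γa − Γa H_{[-(r+1), r+1]²} ∈ 𝔄_{[-(r+1), r+1]²}` — the local density of `[H, C_a]`
(free-boundary `t–t′–U` Hamiltonian, `t = 1`). [cite: BratteliRobinsonII1997, Thm. 6.2.4] -/
def hamCommLocal (tp U : ℝ) (r : ℕ) (a : FermionOp (box 2 r)) : FermionOp (box 2 (r + 1)) :=
  (hubbardTTPrimeFermionInteraction 1 tp U).localHamiltonian (box 2 (r + 1)) *
      fermionEmbed (PolySite.incl (box_subset_box (r_le_r1 r))) a -
    fermionEmbed (PolySite.incl (box_subset_box (r_le_r1 r))) a *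
      (hubbardTTPrimeFermionInteraction 1 tp U).localHamiltonian (box 2 (r + 1))

/-- `m_a = Σ_{z ∈ [-(2r+1), 2r+1]²} [τ_z a, h_a] ∈ 𝔄_{[-(3r+2), 3r+2]²}` — the local density of the double commutator
`[C_a, [H, C_a]]`. [cite: DLS1978, §2 eq. (28)] -/
def doubleCommDensity (tp U : ℝ) (r : ℕ) (a : FermionOp (box 2 r)) : FermionOp (box 2 (3 * r + 2)) :=
  commDensity (box 2 (3 * r + 2)) (box 2 (2 * r + 1)) (box_subset_box (r1_le r)) a (hamCommLocal tp U r a)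

/-- **The trial-generator word** `W_a = ½Γk₀ + i·Γd_a + ½ m_a ∈ 𝔄_{[-(3r+2), 3r+2]²}`; for the Krylov generator this is the
tree's `½Γk₀ + λΓd₁ − (λ²/2)m₃′` up to normalisation. [cite: DLS1978, §2 eqs. (27), (28)] [cite: Lipparini2008, eq. (8.30)] -/
def trialWord (tp U : ℝ) (r : ℕ) (a : FermionOp (box 2 r)) : FermionOp (box 2 (3 * r + 2)) :=
  ((1 / 2 : ℝ) : ℂ) • fermionEmbed (PolySite.incl (box_subset_box (one_le r))) (kinBondObsTT tp) +
    Complex.I • fermionEmbed (PolySite.incl (box_subset_box (r2_le r))) (curCommDensity tp r a) +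
    ((1 / 2 : ℝ) : ℂ) • doubleCommDensity tp U r a

/-- Admissible local trial generators: Hermitian, even, conserving `N` and `S^z` (so `C_a` acts in the canonical sectors). -/
def IsTrialGenerator (r : ℕ) (a : FermionOp (box 2 r)) : Prop :=
  a.IsHermitian ∧ a ∈ carEvenSubalgebra (Finset.univ : Finset (Orb (PolySite (box 2 r)))) ∧
    Commute a totalNumber ∧ Commute a HubbardWave0.spinZ

/-- The lattice-gas chemical-potential band of `HubbardTTPrimeChemicalPotentialBand` (`exists_chemicalPotential_mem_band`). -/
def InMuBand (β t tp U n μ : ℝ) : Prop :=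
  Real.log (n / (2 - n)) / β - (4 * |t| + 4 * |tp|) ≤ μ ∧ μ ≤ Real.log (n / (2 - n)) / β + (4 * |t| + 4 * |tp| + U)

/-- **Thermal row states** at `(β; 1, t′, U; n)` and chemical potential `μ₀`: translation-invariant states of density `n` satisfying
the stationarity and energy–entropy-balance rows for EVERY local generator w.r.t. the grand-canonical local dynamics
`K_{Λ′} = gcLocalHamiltonianTT' Λ′ 1 t′ U μ₀ 0` (row shapes VERBATIM those of
`IsTorusLimitOfMixture.exists_chemicalPotential_rows_of_sectorGibbs`) and the canonical Bogoliubov rows for gauge-invariant pairs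
(VERBATIM `IsTorusLimitOfMixture.re_expect_bog_nonneg_of_sectorGibbs_of_thicken_subset`). The feasible set of the T > 0 relaxations.
[cite: FawziFawziScalet2024, Thm. 3.1] [cite: DLS1978, §2 eq. (28)] -/
def IsThermalRowState (β tp U n μ₀ : ℝ) (ω : InfVolFermionState 2) : Prop :=
  ω.IsTranslationInvariant ∧ ω.density = n ∧
    (∀ (Λ Λ' : Finset (Site 2)) (hΛ : Λ ⊆ Λ') (_h8 : thicken Λ 1 ⊆ Λ') (A : FermionOp Λ),
      ω.expect Λ'
          (gcLocalHamiltonianTT' Λ' 1 tp U μ₀ 0 * fermionEmbed (PolySite.incl hΛ) A -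
            fermionEmbed (PolySite.incl hΛ) A * gcLocalHamiltonianTT' Λ' 1 tp U μ₀ 0) = 0 ∧
        ∀ (s q : ℝ), Real.exp (s - 1) ≤ q →
          0 ≤ (ω.expect Λ'
            (((β : ℝ) : ℂ) • ((fermionEmbed (PolySite.incl hΛ) A)ᴴ *
                (gcLocalHamiltonianTT' Λ' 1 tp U μ₀ 0 * fermionEmbed (PolySite.incl hΛ) A -
                  fermionEmbed (PolySite.incl hΛ) A * gcLocalHamiltonianTT' Λ' 1 tp U μ₀ 0)) -
              ((s : ℝ) : ℂ) • ((fermionEmbed (PolySite.incl hΛ) A)ᴴ * fermionEmbed (PolySite.incl hΛ) A) +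
              ((q : ℝ) : ℂ) • (fermionEmbed (PolySite.incl hΛ) A * (fermionEmbed (PolySite.incl hΛ) A)ᴴ))).re) ∧
    (∀ (Λ Λ' : Finset (Site 2)) (hΛ : Λ ⊆ Λ') (_h8 : thicken Λ 1 ⊆ Λ') (A C : FermionOp Λ),
      Commute A totalNumber → Commute A HubbardWave0.spinZ → Commute C totalNumber → Commute C HubbardWave0.spinZ →
      0 ≤ (ω.expect Λ'
        (fermionEmbed (PolySite.incl hΛ) A * (fermionEmbed (PolySite.incl hΛ) A)ᴴ +
            (fermionEmbed (PolySite.incl hΛ) A)ᴴ * fermionEmbed (PolySite.incl hΛ) A +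
            ((2 : ℝ) : ℂ) • (fermionEmbed (PolySite.incl hΛ) C * fermionEmbed (PolySite.incl hΛ) A -
              fermionEmbed (PolySite.incl hΛ) A * fermionEmbed (PolySite.incl hΛ) C) +
            ((β / 2 : ℝ) : ℂ) • ((fermionEmbed (PolySite.incl hΛ) C)ᴴ *
                ((hubbardTTPrimeFermionInteraction 1 tp U).localHamiltonian Λ' * fermionEmbed (PolySite.incl hΛ) C -
                  fermionEmbed (PolySite.incl hΛ) C * (hubbardTTPrimeFermionInteraction 1 tp U).localHamiltonian Λ') -
              ((hubbardTTPrimeFermionInteraction 1 tp U).localHamiltonian Λ' * fermionEmbed (PolySite.incl hΛ) C -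
                  fermionEmbed (PolySite.incl hΛ) C * (hubbardTTPrimeFermionInteraction 1 tp U).localHamiltonian Λ') *
                (fermionEmbed (PolySite.incl hΛ) C)ᴴ))).re)

/-! ## §1 The statements of the lines: the hook (STUB 1), the supporting chemical potentials, the K1 certificate (STUB 2) -/

/-- Statement of STUB 1 (general local-trial-generator thermal hook). -/
def TrialGeneratorHook : Prop :=
  ∀ {tp U n β : ℝ}, 0 < β → 0 ≤ n → n ≤ 2 → ∀ (r : ℕ) (a : FermionOp (box 2 r)), IsTrialGenerator r a → ∀ {q : ℚ},
    (∀ (ω : InfVolFermionState 2) (Ls : ℕ → ℕ), Tendsto Ls atTop atTop →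
      ω.IsTorusLimitOfMixture (sectorGibbsCount n) (fun L => sectorGibbsWeightTT' β 1 tp U n L)
        (fun L => sectorGibbsVectorTT' 1 tp U n L) Ls →
      (ω.expect (box 2 (3 * r + 2)) (trialWord tp U r a)).re ≤ ((q : ℚ) : ℝ)) →
    ObsThermalStiffnessSeqCeilingAtBeta tp U n β q

/-- Supporting chemical potentials of the canonical pressure `p(β; t, t′, U; ·)` at density `n` (the Legendre contact set; VERBATIM the
equation of `exists_chemicalPotential_mem_band`). -/
def IsSupportingMu (β t tp U n μ : ℝ) : Prop :=
  pressureTT' β t tp U n + β * μ * n = gcPressureTT' β t tp U μ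

/-- Statement of STUB 2 (the certificate, per banded supporting `μ₀`; crit-2's STUB 3″ ∧ band). -/
def TrialGeneratorCertificateB10 : Prop :=
  ∀ μ₀ : ℝ, InMuBand 10 1 0 8 (7 / 8) μ₀ → IsSupportingMu 10 1 0 8 (7 / 8) μ₀ →
    ∃ (r : ℕ) (a : FermionOp (box 2 r)), IsTrialGenerator r a ∧
      ∀ ω : InfVolFermionState 2, IsThermalRowState 10 0 8 (7 / 8) μ₀ ω →
        (ω.expect (box 2 (3 * r + 2)) (trialWord 0 8 r a)).re ≤ (((1 / 8 : ℚ) : ℚ) : ℝ)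

/-! ## §4 The generic `(β, q)` certificate statement at the anchor (rung socket of M-K1-R1) -/

/-- Generic `(β, q)` form of the line's certificate statement at the anchor `(U, n, t′) = (8, 7/8, 0)` (STUB 2 is the instance `(10, 1/8)`). -/
def TrialGeneratorCertificateAt (β : ℝ) (q : ℚ) : Prop :=
  ∀ μ₀ : ℝ, InMuBand β 1 0 8 (7 / 8) μ₀ → IsSupportingMu β 1 0 8 (7 / 8) μ₀ →
    ∃ (r : ℕ) (a : FermionOp (box 2 r)), IsTrialGenerator r a ∧
      ∀ ω : InfVolFermionState 2, IsThermalRowState β 0 8 (7 / 8) μ₀ ω →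
        (ω.expect (box 2 (3 * r + 2)) (trialWord 0 8 r a)).re ≤ ((q : ℚ) : ℝ)

/-- STUB 2's registered statement is literally the `(10, 1/8)` instance. -/
theorem trialGeneratorCertificateB10_iff : TrialGeneratorCertificateB10 ↔ TrialGeneratorCertificateAt 10 (1 / 8) := Iff.rfl

end Summit.Ventures.CertifiedManyBodySolver.Theorems.TcThermcert1
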